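import Summits.Ventures.YMGap.RobustBall.LoopScreening
import Summits.Ventures.YMGap.RobustBall.LoopScreeningMember
import HarnessLib

/-!
# Venture YMGap, track ROBUST-BALL — the tier-2 area law without a vertical window is FALSE
# (`not_areaLawOnBallC`): fundamental loop terms screen the Wilson loop

HONEST FRAMING. WHAT THIS IS: a venture file (cell `pub-ymgap`, track Y2 ROBUST-BALL, seat lit-1 g5), a
NEGATIVE result about a TARGET SHAPE of this track — nothing about the continuum limit or a Clay-sense
mass gap, and nothing against the honest tier-2 area law `AreaLawOnBallW … mv` (vertical dependence
window `mv`, rb-theory ROBUST-BALL-STATEMENT §6), which no loop term of a large loop satisfies.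

THE STATEMENT REFUTED. `AreaLawOnBallC N d β κ ε₀ ε₁` (`LoopScreeningDefs`): constants `C, c > 0` with
`|⟨W_{R×T}⟩_{β,W,L}| ≤ C^{2(R+T)} e^{-c R T}` for every torus `L`, every member `W` of the tier-2 ball
`ClusterDomain κ ε₀ ε₁` whose total is centre-slab invariant, and every non-winding rectangle.

THE MECHANISM (in print: loop terms with activity `∝ K^{|C|} Re tr_F U_C` are the hopping expansion of
a heavy matter field in the FUNDAMENTAL representation, Montvay–Münster (5.30)–(5.31); fundamental
matter breaks the centre symmetry "trivially" on each slab and turns the area law into a PERIMETER law,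
Fradkin–Shenker 1979, Greensite LNP 821 Ch. 3, Ch. 15 (15.11)). Formally, for the `n × n` square `C` on the
torus `L = 2n`, the one-term perturbation `W = σ t_n · W_C` (`LoopScreening.loopTerm`), with
`t_n = A e^{-|κ| n} / (4n (1 + 4 n d))`, `A = min(ε₀/2, ε₁)`:
* is in `ClusterDomain κ ε₀ ε₁` (`loopTerm_mem_clusterDomain`: its one polymer has diameter `≤ n` and
  `≤ 4n` sites) and its total is centre-slab invariant (`loopTerm_total_centerSlabRotate`, this file:
  a non-winding rectangle crosses each slab once up and once down and central elements commute through);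
* for one sign `σ = ±1` screens its own loop: `|⟨W_C⟩_{β,W}| ≥ t_n e^{-2 t_n} e^{-|β| B} v_N`
  (`exists_sign_abs_expectation_wilsonLoop_ge_SU`: exponential-tilt monotonicity + a one-link Haar
  variance floor; `v_N > 0` for `N ≥ 2`, `haarTraceVariance_fundamentalRep_pos`).
Since `t_n` decays only like `e^{-|κ| n} / n²` (PERIMETER), `C^{4n} e^{-c n²}` cannot dominate it:
`not_areaLawOnBallC`. Consequence for the track (rb-theory §6, N-7″): the tier-2 area-law target must
keep a vertical dependence window (or exclude loop-sized polymers by range), exactly as tier 1 does.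

## References
* I. Montvay, G. Münster, *Quantum Fields on a Lattice* (1994), §5.1.3 (5.30)–(5.31). [MontvayMunster1994]
* E. Fradkin, S. Shenker, Phys. Rev. D 19 (1979) 3682. [FradkinShenker1979]
* J. Greensite, *An Introduction to the Confinement Problem*, LNP 821 (2011), §3.2, Ch. 15 (15.11). [Greensite2011]
-/

noncomputable section

open MeasureTheory Real Finset Filter Topology
open Literature.Probability.LatticeModels Literature.Probability.LatticeModels.DobrushinMetric
open Literature.MathematicalPhysics.QuantumFieldTheory
open Literature.MathematicalPhysics.QuantumLattice (fundamentalRep fundamentalRep_apply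
  continuous_fundamentalRep)

namespace Summit.Ventures.YMGap.RobustBall

namespace LoopScreening

variable {d L N : ℕ}

/-! ### Centre-slab invariance of the loop term -/

section Centre

/-- Lines in a direction other than `v` do not read `v`-links. [folklore] -/
theorem lineHolonomy_centerSlabRotate_of_ne {k v : Fin d} (hkv : k ≠ v) (τ : ZMod L) (z : SUN N)
    (U : GaugeConfig d L (SUN N)) (n : ℕ) (y : Site d L) :
    lineHolonomy (centerSlabRotate v τ z U) k n y = lineHolonomy U k n y :=
  lineHolonomy_congr k n y fun s _ => by simp [centerSlabRotate, hkv]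

/-- A `v`-line picks up `z^m`, `m` = the number of its links at `v`-height `τ`, which depends on the
base point only through its `v`-coordinate. [folklore] -/
theorem lineHolonomy_centerSlabRotate_self (v : Fin d) (τ : ZMod L) {z : SUN N}
    (hz : z ∈ Subgroup.center (SUN N)) (U : GaugeConfig d L (SUN N)) :
    ∀ (n : ℕ) (y : Site d L), lineHolonomy (centerSlabRotate v τ z U) v n y =
      z ^ (∑ s ∈ range n, if y v + ((s : ℕ) : ZMod L) = τ then 1 else 0) * lineHolonomy U v n y
  | 0, y => by simp
  | n + 1, y => by
      have hzc : ∀ (m : ℕ) (g : SUN N), g * z ^ m = z ^ m * g := fun m g =>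
        (Subgroup.mem_center_iff.1 (Subgroup.pow_mem _ hz m)) g
      rw [lineHolonomy_succ, lineHolonomy_succ, lineHolonomy_centerSlabRotate_self v τ hz U n (y.shift v),
        Finset.sum_range_succ']
      have hshift : ∀ s : ℕ, (Literature.MathematicalPhysics.QuantumFieldTheory.Site.shift y v) v +
          ((s : ℕ) : ZMod L) = y v + (((s + 1 : ℕ) : ℕ) : ZMod L) := by
        intro s
        simp only [Literature.MathematicalPhysics.QuantumFieldTheory.Site.shift, Pi.add_apply,
          Pi.single_eq_same, Nat.cast_add, Nat.cast_one]
        ring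
      simp only [hshift, Nat.cast_zero, add_zero]
      have hrot : centerSlabRotate v τ z U (y, v) = if y v = τ then z * U (y, v) else U (y, v) := by
        simp [centerSlabRotate]
      rw [hrot]
      split_ifs with h
      · rw [pow_succ']
        calc z * U (y, v) * (z ^ (∑ s ∈ range n, if y v + (((s + 1 : ℕ) : ℕ) : ZMod L) = τ then 1 else 0) *
              lineHolonomy U v n (y.shift v))
            = z * (U (y, v) * z ^ (∑ s ∈ range n, if y v + (((s + 1 : ℕ) : ℕ) : ZMod L) = τ then 1 else 0)) *
              lineHolonomy U v n (y.shift v) := by simp only [mul_assoc]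
          _ = z * (z ^ (∑ s ∈ range n, if y v + (((s + 1 : ℕ) : ℕ) : ZMod L) = τ then 1 else 0) * U (y, v)) *
              lineHolonomy U v n (y.shift v) := by rw [hzc]
          _ = _ := by simp only [mul_assoc]
      · rw [add_zero, ← mul_assoc, hzc, mul_assoc]

/-- **The holonomy of a non-winding rectangle is centre-slab invariant** (`i ≠ j`). [folklore] -/
theorem rectangleHolonomy_centerSlabRotate {x : Site d L} {i j : Fin d} (hij : i ≠ j) (R T : ℕ) (v : Fin d)
    (τ : ZMod L) {z : SUN N} (hz : z ∈ Subgroup.center (SUN N)) (U : GaugeConfig d L (SUN N)) :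
    rectangleHolonomy (centerSlabRotate v τ z U) x i j R T = rectangleHolonomy U x i j R T := by
  have hconj : ∀ (m : ℕ) (g : SUN N), z ^ m * g * (z ^ m)⁻¹ = g := fun m g => by
    rw [← (Subgroup.mem_center_iff.1 (Subgroup.pow_mem _ hz m)) g, mul_inv_cancel_right]
  unfold rectangleHolonomy
  by_cases hvi : v = i
  · subst hvi
    simp only [lineHolonomy_centerSlabRotate_self v τ hz U, lineHolonomy_centerSlabRotate_of_ne (Ne.symm hij),
      Pi.add_apply, Pi.single_eq_of_ne hij, add_zero]
    set m := ∑ s ∈ range R, (if x v + ((s : ℕ) : ZMod L) = τ then 1 else 0) with hm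
    calc z ^ m * lineHolonomy U v R x * lineHolonomy U j T (x + Pi.single v ((R : ℕ) : ZMod L)) *
          (z ^ m * lineHolonomy U v R (x + Pi.single j ((T : ℕ) : ZMod L)))⁻¹ * (lineHolonomy U j T x)⁻¹
        = (z ^ m * (lineHolonomy U v R x * lineHolonomy U j T (x + Pi.single v ((R : ℕ) : ZMod L)) *
          (lineHolonomy U v R (x + Pi.single j ((T : ℕ) : ZMod L)))⁻¹) * (z ^ m)⁻¹) * (lineHolonomy U j T x)⁻¹ := by
          simp only [mul_inv_rev, mul_assoc]
      _ = _ := by rw [hconj]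
  by_cases hvj : v = j
  · subst hvj
    simp only [lineHolonomy_centerSlabRotate_self v τ hz U, lineHolonomy_centerSlabRotate_of_ne hij,
      Pi.add_apply, Pi.single_eq_of_ne (Ne.symm hij), add_zero]
    set m := ∑ s ∈ range T, (if x v + ((s : ℕ) : ZMod L) = τ then 1 else 0) with hm
    calc lineHolonomy U i R x * (z ^ m * lineHolonomy U v T (x + Pi.single i ((R : ℕ) : ZMod L))) *
          (lineHolonomy U i R (x + Pi.single v ((T : ℕ) : ZMod L)))⁻¹ * (z ^ m * lineHolonomy U v T x)⁻¹
        = lineHolonomy U i R x * (z ^ m * (lineHolonomy U v T (x + Pi.single i ((R : ℕ) : ZMod L)) *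
          (lineHolonomy U i R (x + Pi.single v ((T : ℕ) : ZMod L)))⁻¹ * (lineHolonomy U v T x)⁻¹) * (z ^ m)⁻¹) := by
          simp only [mul_inv_rev, mul_assoc]
      _ = _ := by rw [hconj]; simp only [mul_assoc]
  · rw [lineHolonomy_centerSlabRotate_of_ne (Ne.symm hvi), lineHolonomy_centerSlabRotate_of_ne (Ne.symm hvj),
      lineHolonomy_centerSlabRotate_of_ne (Ne.symm hvi), lineHolonomy_centerSlabRotate_of_ne (Ne.symm hvj)]

/-- **The Wilson loop of a non-winding rectangle is centre-slab invariant** (`i ≠ j`). [folklore] -/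
theorem wilsonLoop_centerSlabRotate {x : Site d L} {i j : Fin d} (hij : i ≠ j) (R T : ℕ) (v : Fin d)
    (τ : ZMod L) {z : SUN N} (hz : z ∈ Subgroup.center (SUN N)) (U : GaugeConfig d L (SUN N)) :
    wilsonLoop (fundamentalRep (Fin N)) x i j R T (centerSlabRotate v τ z U) =
      wilsonLoop (fundamentalRep (Fin N)) x i j R T U := by
  simp only [wilsonLoop, rectangleHolonomy_centerSlabRotate hij R T v τ hz U]

/-- **The total of the loop term is centre-slab invariant** (`i ≠ j`). [folklore] -/
theorem loopTerm_total_centerSlabRotate [NeZero L] {x : Site d L} {i j : Fin d} (hij : i ≠ j) (t : ℝ)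
    (R T : ℕ) (v : Fin d) (τ : ZMod L) (z : SUN N) (hz : z ∈ Subgroup.center (SUN N))
    (U : GaugeConfig d L (SUN N)) :
    (loopTerm (fundamentalRep (Fin N)) (continuous_fundamentalRep (Fin N)) t x i j R T).total
        (centerSlabRotate v τ z U) =
      (loopTerm (fundamentalRep (Fin N)) (continuous_fundamentalRep (Fin N)) t x i j R T).total U := by
  rw [loopTerm_total, loopTerm_total, wilsonLoop_centerSlabRotate hij R T v τ hz U]

end Centre

end LoopScreening

/-! ### The no-go theorem -/

section NoGo

open LoopScreening

variable {N d : ℕ}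

/-- **Tier-2 area-law NO-GO.** For `N ≥ 2`, `d ≥ 2` and every `β, κ` and `ε₀, ε₁ > 0`, the area law
uniform on the tier-2 ball `ClusterDomain κ ε₀ ε₁` under centre-slab invariance alone is false:
fundamental loop terms of perimeter size are members and screen their own loop. [folklore] -/
theorem not_areaLawOnBallC (hN : 2 ≤ N) (hd : 2 ≤ d) (β κ : ℝ) {ε₀ ε₁ : ℝ} (hε₀ : 0 < ε₀)
    (hε₁ : 0 < ε₁) : ¬ AreaLawOnBallC N d β κ ε₀ ε₁ := by
  rintro ⟨C, c, hc, h⟩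
  -- constants
  have hV : 0 < exp (-(|β| * linkActionBound d N)) * haarTraceVariance (fundamentalRep (Fin N)) :=
    mul_pos (exp_pos _) (haarTraceVariance_fundamentalRep_pos hN)
  set V : ℝ := exp (-(|β| * linkActionBound d N)) * haarTraceVariance (fundamentalRep (Fin N)) with hVdef
  set A : ℝ := min (ε₀ / 2) ε₁ with hAdef
  have hA : 0 < A := lt_min (by linarith) hε₁
  have hAε₀ : 2 * A ≤ ε₀ := by linarith [min_le_left (ε₀ / 2) ε₁]
  have hAε₁ : A ≤ ε₁ := min_le_right _ _
  set K : ℝ := A * exp (-(2 * A)) * V with hKdef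
  have hK : 0 < K := by positivity
  have hd0 : (0 : ℝ) < d := by exact_mod_cast (show 0 < d by omega)
  -- a side length `n` beyond the crossover
  obtain ⟨n, hn1, hn2, hn3⟩ : ∃ n : ℕ, 1 ≤ n ∧ 4 * |C| + |κ| + 1 ≤ c * n ∧
      (n : ℝ) ^ 2 * exp (-(n : ℝ)) < K / (20 * d) := by
    have e2 : ∀ᶠ n : ℕ in atTop, 4 * |C| + |κ| + 1 ≤ c * n := by
      refine (tendsto_natCast_atTop_atTop.eventually_ge_atTop ((4 * |C| + |κ| + 1) / c)).mono
        fun n hn => ?_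
      exact ((div_le_iff₀ hc).1 hn).trans_eq (mul_comm _ _)
    have e3 : ∀ᶠ n : ℕ in atTop, (n : ℝ) ^ 2 * exp (-(n : ℝ)) < K / (20 * d) :=
      ((tendsto_pow_mul_exp_neg_atTop_nhds_zero 2).comp tendsto_natCast_atTop_atTop).eventually
        (gt_mem_nhds (by positivity))
    obtain ⟨n, ⟨h1, h2⟩, h3⟩ := (((eventually_ge_atTop 1).and e2).and e3).exists
    exact ⟨n, h1, h2, h3⟩
  have hn0 : (1 : ℝ) ≤ n := by exact_mod_cast hn1
  -- the torus `L = 2n`, two directions, the `n × n` square at the origin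
  haveI : NeZero (2 * n) := ⟨by omega⟩
  obtain ⟨i, j, hij⟩ : ∃ i j : Fin d, i ≠ j := ⟨⟨0, by omega⟩, ⟨1, by omega⟩, by simp [Fin.ext_iff]⟩
  -- the coefficient
  set D : ℝ := 4 * n * (1 + 4 * n * d) with hDdef
  have hd1 : (1 : ℝ) ≤ d := by exact_mod_cast (show 1 ≤ d by omega)
  have hD4 : 4 ≤ D := by
    have h1 : (0 : ℝ) ≤ 4 * n * d := by positivity
    rw [hDdef]; nlinarith
  have hDpos : 0 < D := by linarith
  have hD20 : D ≤ 20 * d * (n : ℝ) ^ 2 := by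
    have h1 : (1 : ℝ) ≤ d * n := by nlinarith
    have h2 : (0 : ℝ) ≤ 4 * n * (d * n - 1) := mul_nonneg (by positivity) (by linarith)
    have h3 : 20 * d * (n : ℝ) ^ 2 - 4 * n * (1 + 4 * n * d) = 4 * n * (d * n - 1) := by ring
    rw [hDdef, ← sub_nonneg, h3]; exact h2
  set t : ℝ := A * exp (-(|κ| * n)) / D with htdef
  have ht0 : 0 ≤ t := by positivity
  have htA : t ≤ A := by
    rw [htdef, div_le_iff₀ hDpos]
    calc A * exp (-(|κ| * n)) ≤ A * 1 :=
          mul_le_mul_of_nonneg_left (exp_le_one_iff.2 (by nlinarith [abs_nonneg κ])) hA.le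
      _ ≤ A * D := by nlinarith
  have hdiam : ((polymerDiam (loopSites (0 : Site d (2 * n)) i j n n) : ℕ) : ℝ) ≤ n := by
    exact_mod_cast (polymerDiam_loopSites_le (x := (0 : Site d (2 * n))) hij n n).trans (max_self n).le
  have hte : t * exp (κ * polymerDiam (loopSites (0 : Site d (2 * n)) i j n n)) ≤ A / D := by
    have hk : κ * polymerDiam (loopSites (0 : Site d (2 * n)) i j n n) ≤ |κ| * n :=
      (mul_le_mul_of_nonneg_right (le_abs_self κ) (Nat.cast_nonneg _)).trans
        (mul_le_mul_of_nonneg_left hdiam (abs_nonneg κ))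
    calc t * exp (κ * polymerDiam (loopSites (0 : Site d (2 * n)) i j n n))
        ≤ t * exp (|κ| * n) := mul_le_mul_of_nonneg_left (exp_le_exp.2 hk) ht0
      _ = A / D := by rw [htdef, exp_neg]; field_simp
  have hcard : ((((loopSites (0 : Site d (2 * n)) i j n n).card * d : ℕ) : ℕ) : ℝ) ≤ 4 * n * d := by
    have h1 := card_loopSites_le (0 : Site d (2 * n)) i j n n
    have h2 : (loopSites (0 : Site d (2 * n)) i j n n).card * d ≤ (4 * n) * d :=
      Nat.mul_le_mul_right d (by omega)
    exact_mod_cast h2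
  -- the screening member, for the right sign
  obtain ⟨σ, hσ, hlow⟩ := exists_sign_abs_expectation_wilsonLoop_ge_SU (N := N) β
    (x := (0 : Site d (2 * n))) hij (R := n) (T := n) hn1 (by omega) hn1 (by omega) ht0
  have hσt : |σ * t| = t := by
    rcases hσ with rfl | rfl <;> simp [abs_of_nonneg ht0]
  have hmem : loopTerm (fundamentalRep (Fin N)) (continuous_fundamentalRep (Fin N)) (σ * t)
      (0 : Site d (2 * n)) i j n n ∈ ClusterDomain (d := d) (L := 2 * n) (N := N) κ ε₀ ε₁ := by
    refine loopTerm_mem_clusterDomain (σ * t) 0 i j n n ?_ ?_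
    · rw [hσt]
      calc 2 * t * exp (κ * polymerDiam (loopSites (0 : Site d (2 * n)) i j n n)) ≤ 2 * (A / D) := by
            rw [mul_assoc]; exact mul_le_mul_of_nonneg_left hte (by norm_num)
        _ ≤ 2 * (A / 4) := by gcongr
        _ ≤ ε₀ := by linarith
    · rw [hσt]
      calc t * ((2 * (n + n) : ℕ) : ℝ) * exp (κ * polymerDiam (loopSites (0 : Site d (2 * n)) i j n n)) *
            (1 + ((((loopSites (0 : Site d (2 * n)) i j n n).card * d : ℕ) : ℕ) : ℝ))
          = (t * exp (κ * polymerDiam (loopSites (0 : Site d (2 * n)) i j n n))) * (4 * n) *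
            (1 + ((((loopSites (0 : Site d (2 * n)) i j n n).card * d : ℕ) : ℕ) : ℝ)) := by
            push_cast; ring
        _ ≤ (A / D) * (4 * n) * (1 + 4 * n * d) :=
            mul_le_mul (mul_le_mul_of_nonneg_right hte (by positivity)) (by linarith) (by positivity)
              (by positivity)
        _ = A := by rw [hDdef]; field_simp
        _ ≤ ε₁ := hAε₁
  have hctr : ∀ (v : Fin d) (τ : ZMod (2 * n)) (z : SUN N), z ∈ Subgroup.center (SUN N) → ∀ U,
      (loopTerm (fundamentalRep (Fin N)) (continuous_fundamentalRep (Fin N)) (σ * t)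
        (0 : Site d (2 * n)) i j n n).total (centerSlabRotate v τ z U) =
      (loopTerm (fundamentalRep (Fin N)) (continuous_fundamentalRep (Fin N)) (σ * t)
        (0 : Site d (2 * n)) i j n n).total U :=
    fun v τ z hz U => loopTerm_total_centerSlabRotate hij (σ * t) n n v τ z hz U
  have hup := h (2 * n) _ hmem hctr 0 i j n n hij hn1 hn1 le_rfl le_rfl
  -- upper bound `C^{4n} e^{-c n²} ≤ e^{(4|C|) n - c n²}`
  have hC : C ^ (2 * (n + n)) ≤ exp (4 * |C| * n) := by
    calc C ^ (2 * (n + n)) ≤ |C| ^ (2 * (n + n)) := by rw [← abs_pow]; exact le_abs_self _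
      _ ≤ (exp |C|) ^ (2 * (n + n)) :=
          pow_le_pow_left₀ (abs_nonneg C) (by linarith [add_one_le_exp |C|]) _
      _ = exp (4 * |C| * n) := by rw [← exp_nat_mul]; push_cast; ring_nf
  -- lower bound `K e^{-|κ| n} / (20 d n²) ≤ t e^{-2t} V`
  have hlow' : K * exp (-(|κ| * n)) / (20 * d * (n : ℝ) ^ 2) ≤ t * exp (-(2 * t)) * V := by
    have i1 : A * exp (-(|κ| * n)) / (20 * d * (n : ℝ) ^ 2) ≤ t :=
      div_le_div_of_nonneg_left (by positivity) hDpos hD20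
    have i2 : exp (-(2 * A)) ≤ exp (-(2 * t)) := exp_le_exp.2 (by linarith)
    calc K * exp (-(|κ| * n)) / (20 * d * (n : ℝ) ^ 2)
        = A * exp (-(|κ| * n)) / (20 * d * (n : ℝ) ^ 2) * exp (-(2 * A)) * V := by rw [hKdef]; ring
      _ ≤ t * exp (-(2 * t)) * V :=
          mul_le_mul_of_nonneg_right (mul_le_mul i1 i2 (exp_pos _).le ht0) hV.le
  -- combine: `K ≤ 20 d n² e^{(4|C| + |κ|) n - c n²} ≤ 20 d n² e^{-n} < K`
  have hchain : K * exp (-(|κ| * n)) / (20 * d * (n : ℝ) ^ 2) ≤ exp (4 * |C| * n) * exp (-c * (n * n)) := by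
    rw [hVdef] at hlow'
    refine hlow'.trans (hlow.trans (hup.trans ?_))
    exact mul_le_mul_of_nonneg_right hC (exp_pos _).le
  have hK' : K ≤ 20 * d * (n : ℝ) ^ 2 * exp (-(n : ℝ)) := by
    have hpos : 0 < 20 * d * (n : ℝ) ^ 2 := by positivity
    rw [div_le_iff₀ hpos] at hchain
    have hexp : exp (4 * |C| * n) * exp (-c * (n * n)) ≤ exp (-(n : ℝ)) * exp (-(|κ| * n)) := by
      rw [← exp_add, ← exp_add, exp_le_exp]
      nlinarith
    calc K = K * exp (-(|κ| * n)) * exp (|κ| * n) := by rw [mul_assoc, ← exp_add]; simp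
      _ ≤ exp (4 * |C| * n) * exp (-c * (n * n)) * (20 * d * (n : ℝ) ^ 2) * exp (|κ| * n) :=
          mul_le_mul_of_nonneg_right hchain (exp_pos _).le
      _ ≤ exp (-(n : ℝ)) * exp (-(|κ| * n)) * (20 * d * (n : ℝ) ^ 2) * exp (|κ| * n) :=
          mul_le_mul_of_nonneg_right (mul_le_mul_of_nonneg_right hexp hpos.le) (exp_pos _).le
      _ = 20 * d * (n : ℝ) ^ 2 * exp (-(n : ℝ)) := by
          rw [show exp (-(n : ℝ)) * exp (-(|κ| * n)) * (20 * d * (n : ℝ) ^ 2) * exp (|κ| * n) =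
            20 * d * (n : ℝ) ^ 2 * exp (-(n : ℝ)) * (exp (-(|κ| * n)) * exp (|κ| * n)) by ring,
            ← exp_add]
          simp
  have : 20 * d * ((n : ℝ) ^ 2 * exp (-(n : ℝ))) < 20 * d * (K / (20 * d)) :=
    mul_lt_mul_of_pos_left hn3 (by positivity)
  rw [mul_div_cancel₀ _ (by positivity : (20 * d : ℝ) ≠ 0)] at this
  linarith

end NoGo

end Summit.Ventures.YMGap.RobustBall
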